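import Summits.Ventures.Crystal3D.Theorems.StickyWulffConstantCoaxialWallLawOffSite
import HarnessLib

/-!
# The off-site budget of `stub_coaxialTwoSlabAdhesion`, II-b: the count form — six per off-site ball near the window

HONEST FRAMING. Part of the venture `Summits/Ventures/Crystal3D` (cell `crystal3d-full`), helper
`--supports` the crux `CoaxialWallLaw` (stmt-Ventures-19481, `route-Ventures-StickyWulffConstant`),
REGISTERED line `WallLedgerF` (planner cf-p1 gen 16), open stub `stub_coaxialTwoSlabAdhesion`.
RUNG CREDIT ONLY; F-C1 not moved.

`…CoaxialWallLawOffSite.coaxialTwoSlabAdhesion_offSite` bounds the adhesion excess of an ARBITRARY filling by the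
charge `(√6/3)·sin θ` up to `½·B`, `B` = the number of (on-site riser ball, off-site ball) contacts in the payer
window.  Every off-site ball has at most twelve contacts, all within height `1` of itself, so `B ≤ 12 · #{off-site
balls q with −R₀ − 3 ≤ q₂ ≤ h + R₀ + 3}` (double count), whence the quotable form:

* **`coaxialTwoSlabAdhesion_offSite_count`** — for every filling of the stub's cell,
  `cross(P₁, X∖P₁) + cross(P₂, Y) ≤ D(Y) + (φ₁ + φ₂ − (√6/3)·sin θ) πρ² + C(1+h)ρ + 6 · #OFF`,
  `OFF` = the balls of `X` off the co-axial site lattice of `(L, s₁)` with `−R₀−3 ≤ q₂ ≤ h+R₀+3`.  Reading: a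
  filling that beats the charge `c · sin θ` contains at least `((√6/3 − c)/6) · sin θ · πρ² − O((1+h)ρ)` off-site
  balls at the wall (a positive DENSITY per unit wall area as soon as `sin θ > 0`).

WHAT THIS IS NOT: nothing about where the off-site balls are beyond the height window (see `…OffSitePinning`); F-C1
not moved.
-/

noncomputable section

namespace Summit.Ventures.Crystal3D.Theorems

open Summit.Ventures.Crystal3D Finset
open Literature.MathematicalPhysics.StatisticalMechanics (fccStacking barlowStacking IsHaggSeq
  contactDeficiency triangularVec₁ triangularVec₂ barlowOffset layerNormal)
open scoped InnerProductSpace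

open scoped Classical in
/-- **The off-site budget, count form.**  See the module docstring. -/
theorem coaxialTwoSlabAdhesion_offSite_count
    (A₁ : EuclideanSpace ℝ (Fin 3) ≃ₗᵢ[ℝ] EuclideanSpace ℝ (Fin 3)) (t₁ : EuclideanSpace ℝ (Fin 3))
    (A₂ : EuclideanSpace ℝ (Fin 3) ≃ₗᵢ[ℝ] EuclideanSpace ℝ (Fin 3)) (t₂ : EuclideanSpace ℝ (Fin 3))
    (L : EuclideanSpace ℝ (Fin 3) ≃ₗᵢ[ℝ] EuclideanSpace ℝ (Fin 3)) (s₁ s₂ : EuclideanSpace ℝ (Fin 3))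
    {σ σ' : ℤ → ℤ} (hσ : IsHaggSeq σ) (hσ' : IsHaggSeq σ')
    (hsub₁ : (fun p => A₁ p + t₁) '' fccStacking 1 (Real.sqrt (2 / 3)) ⊆
      (fun p => L p + s₁) '' barlowStacking 1 (Real.sqrt (2 / 3)) σ)
    (hsub₂ : (fun p => A₂ p + t₂) '' fccStacking 1 (Real.sqrt (2 / 3)) ⊆
      (fun p => L p + s₂) '' barlowStacking 1 (Real.sqrt (2 / 3)) σ')
    (hne : (fun p => A₁ p + t₁) '' fccStacking 1 (Real.sqrt (2 / 3)) ≠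
      (fun p => A₂ p + t₂) '' fccStacking 1 (Real.sqrt (2 / 3))) :
    ∃ C R₀ : ℝ, 1 ≤ R₀ ∧ ∀ h : ℝ, 0 ≤ h → ∀ ρ : ℝ, R₀ ≤ ρ →
      ∀ X P₁ P₂ : Finset (EuclideanSpace ℝ (Fin 3)),
      (∀ p ∈ X, ∀ q ∈ X, p ≠ q → 1 ≤ dist p q) → P₁ ⊆ X → P₂ ⊆ X \ P₁ →
      (∀ p ∈ X, -(2 * R₀) ≤ p 2 ∧ p 2 ≤ h + 2 * R₀ ∧ p 0 ^ 2 + p 1 ^ 2 ≤ ρ ^ 2) →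
      (∀ p, p ∈ P₁ ↔ (p ∈ (fun q => A₁ q + t₁) '' fccStacking 1 (Real.sqrt (2 / 3)) ∧
        -(2 * R₀) ≤ p 2 ∧ p 2 ≤ -R₀ ∧ p 0 ^ 2 + p 1 ^ 2 ≤ ρ ^ 2)) →
      (∀ p, p ∈ P₂ ↔ (p ∈ (fun q => A₂ q + t₂) '' fccStacking 1 (Real.sqrt (2 / 3)) ∧
        h + R₀ ≤ p 2 ∧ p 2 ≤ h + 2 * R₀ ∧ p 0 ^ 2 + p 1 ^ 2 ≤ ρ ^ 2)) →
      ((((P₁ ×ˢ (X \ P₁)).filter fun pq => dist pq.1 pq.2 = 1).card : ℕ) : ℝ) +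
        ((((P₂ ×ˢ ((X \ P₁) \ P₂)).filter fun pq => dist pq.1 pq.2 = 1).card : ℕ) : ℝ) ≤
        contactDeficiency ((X \ P₁) \ P₂) +
          (Real.sqrt 2 / 4 * ∑ᶠ w ∈ {w ∈ fccStacking 1 (Real.sqrt (2 / 3)) | ‖w‖ = 1},
              |⟪w, A₁.symm (EuclideanSpace.single (2 : Fin 3) (1 : ℝ))⟫_ℝ| +
            Real.sqrt 2 / 4 * ∑ᶠ w ∈ {w ∈ fccStacking 1 (Real.sqrt (2 / 3)) | ‖w‖ = 1},
              |⟪w, A₂.symm (EuclideanSpace.single (2 : Fin 3) (1 : ℝ))⟫_ℝ| -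
            (Real.sqrt 6 / 3 : ℝ) * Real.sqrt (1 - ⟪L (EuclideanSpace.single (2 : Fin 3) (1 : ℝ)),
              (EuclideanSpace.single (2 : Fin 3) (1 : ℝ))⟫_ℝ ^ 2)) * Real.pi * ρ ^ 2 +
          C * (1 + h) * ρ +
          6 * ((X.filter fun q => (-R₀ - 3 ≤ q 2 ∧ q 2 ≤ h + R₀ + 3) ∧ ¬ ∃ i j c k : ℤ,
            q = L ((i : ℝ) • triangularVec₁ (1 : ℝ) + (j : ℝ) • triangularVec₂ (1 : ℝ) + (c : ℝ) • barlowOffset (1 : ℝ) +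
              (k : ℝ) • layerNormal (Real.sqrt (2 / 3))) + s₁).card : ℝ) := by
  obtain ⟨C, R₀, hR₀, hmain⟩ := coaxialTwoSlabAdhesion_offSite A₁ t₁ A₂ t₂ L s₁ s₂ hσ hσ' hsub₁ hsub₂ hne
  refine ⟨C, R₀, hR₀, ?_⟩
  intro h hh ρ hρ X P₁ P₂ hX hP₁X hP₂X hcell hP₁ hP₂
  have hfin := hmain h hh ρ hρ X P₁ P₂ hX hP₁X hP₂X hcell hP₁ hP₂
  -- names
  set IsSite : EuclideanSpace ℝ (Fin 3) → Prop := fun q => ∃ i j c k : ℤ,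
    q = L ((i : ℝ) • triangularVec₁ (1 : ℝ) + (j : ℝ) • triangularVec₂ (1 : ℝ) + (c : ℝ) • barlowOffset (1 : ℝ) +
      (k : ℝ) • layerNormal (Real.sqrt (2 / 3))) + s₁ with hIsSite
  set R := X.filter (fun z => (-R₀ - 2 ≤ z 2 ∧ z 2 ≤ h + R₀ + 2) ∧ IsSite z ∧
    ∃ d ∈ ({L (triangularVec₁ 1), -L (triangularVec₁ 1), L (triangularVec₂ 1), -L (triangularVec₂ 1),
      L (triangularVec₂ 1 - triangularVec₁ 1), -L (triangularVec₂ 1 - triangularVec₁ 1)} :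
      Finset (EuclideanSpace ℝ (Fin 3))), z + d ∉ X) with hR
  set OFF := X.filter (fun q => (-R₀ - 3 ≤ q 2 ∧ q 2 ≤ h + R₀ + 3) ∧ ¬ IsSite q) with hOFF
  -- (1) each summand counts off-site contacts, all of them near the window
  have h1 : ∀ z ∈ R, (X.filter fun q => dist z q = 1 ∧ ¬ IsSite q).card ≤ (OFF.filter fun q => dist z q = 1).card := by
    intro z hz
    refine card_le_card ?_
    intro q hq
    rw [mem_filter] at hq
    obtain ⟨hqX, hqd, hqns⟩ := hq
    have hzw := (mem_filter.1 hz).2.1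
    have hzq : |z 2 - q 2| ≤ 1 := by
      have hsq := dist_sq_eq_three z q
      rw [hqd, one_pow] at hsq
      rw [abs_le]
      constructor <;> nlinarith [sq_nonneg (z 0 - q 0), sq_nonneg (z 1 - q 1), sq_nonneg (z 2 - q 2 - 1),
        sq_nonneg (z 2 - q 2 + 1)]
    rw [abs_le] at hzq
    rw [mem_filter, hOFF, mem_filter]
    exact ⟨⟨hqX, ⟨by linarith [hzw.1], by linarith [hzw.2]⟩, hqns⟩, hqd⟩
  -- (2) double count
  have h2 : ∑ z ∈ R, (OFF.filter fun q => dist z q = 1).card = ∑ q ∈ OFF, (R.filter fun z => dist z q = 1).card := by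
    rw [Finset.sum_congr rfl (fun z _ => Finset.card_filter (fun q => dist z q = 1) OFF), Finset.sum_comm]
    refine sum_congr rfl fun q _ => ?_
    rw [Finset.card_filter]
  -- (3) at most twelve contacts per ball
  have h3 : ∀ q ∈ OFF, (R.filter fun z => dist z q = 1).card ≤ 12 := by
    intro q hq
    have hqX : q ∈ X := (mem_filter.1 hq).1
    refine le_trans (card_le_card ?_) (card_filter_dist_eq_one_le_twelve X hX q)
    intro z hz
    rw [mem_filter] at hz ⊢
    exact ⟨(mem_filter.1 hz.1).1, by rw [dist_comm]; exact hz.2⟩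
  have hB : ∑ z ∈ R, ((X.filter fun q => dist z q = 1 ∧ ¬ IsSite q).card : ℝ) ≤ 12 * (OFF.card : ℝ) := by
    have hnat : ∑ z ∈ R, (X.filter fun q => dist z q = 1 ∧ ¬ IsSite q).card ≤ 12 * OFF.card := by
      calc ∑ z ∈ R, (X.filter fun q => dist z q = 1 ∧ ¬ IsSite q).card
          ≤ ∑ z ∈ R, (OFF.filter fun q => dist z q = 1).card := sum_le_sum h1
        _ = ∑ q ∈ OFF, (R.filter fun z => dist z q = 1).card := h2
        _ ≤ ∑ q ∈ OFF, 12 := sum_le_sum h3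
        _ = 12 * OFF.card := by rw [sum_const, smul_eq_mul, mul_comm]
    have := (Nat.cast_le (α := ℝ)).2 hnat
    push_cast at this
    exact this
  linarith [hfin, hB]

end Summit.Ventures.Crystal3D.Theorems

end
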